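import Summits.AtomisticToContinuum.HydrodynamicLimit.Theorems.BoltzmannGreenKubo.Negative.Stationarity
import Summits.AtomisticToContinuum.HydrodynamicLimit.Theorems.BoltzmannGreenKubo.Negative.JointMeasurability

/-!
# Stationary time averages: `∫ (∫₀ʰ X(Φ_r z) dr) dG_N = h ∫ X dG_N` (helper file 4/7)

Fubini on `[0, h] × G_N` (joint a.e.-measurability of the flow, file 2) and stationarity slice by slice (file 1):
`integrable_comp_flow_prod`, `integral_window_eq`, `integrable_window`.
refuter-cdisprove-stmt-AtomisticToContinuum-13985-0 (crux BoltzmannGreenKubo, stmt-13985; infrastructure of the Mazur-floor refutation `Negative/OrthMomentum.lean`, see `Cruxes/BoltzmannGreenKubo/Disproof.lean` §1d–§1h).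
-/

noncomputable section

namespace Summit.AtomisticToContinuum.HydrodynamicLimit.Theorems

open MeasureTheory ProbabilityTheory Filter Topology Set
open Literature.Analysis.FluidPDE Literature.MathematicalPhysics.KineticTheory
open Literature.Analysis.UnboundedOperators
open scoped InnerProductSpace

namespace BoltzmannGreenKuboOrthMomentum

section TimeAverage

variable {σ : ℝ} {N : ℕ}

/-- The constant-profile Gibbs law does not charge the bad set. [folklore] -/
theorem localGibbsLaw_compl_good (c θ : ℝ) (u : V3)
    (Φ : HardSphereFlow (Torus.geometry (Fin 3)) (hsDiameter σ N) (N + 1)) :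
    localGibbsLaw σ (fun _ => c) (fun _ => u) (fun _ => θ) N Φ Φ.goodᶜ = 0 := by
  have h : localGibbsLaw σ (fun _ => c) (fun _ => u) (fun _ => θ) N Φ ≪
      liouville (Torus.geometry (Fin 3)) (N + 1) (hsDiameter σ N) := by
    unfold localGibbsLaw
    rw [particleLaw_eq]
    exact withDensity_absolutelyContinuous _ _
  exact h Φ.measure_compl_good

/-- A.e. every datum is good under the constant-profile Gibbs law. [folklore] -/
theorem ae_mem_good_localGibbsLaw' (c θ : ℝ) (u : V3)
    (Φ : HardSphereFlow (Torus.geometry (Fin 3)) (hsDiameter σ N) (N + 1)) :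
    ∀ᵐ z ∂(localGibbsLaw σ (fun _ => c) (fun _ => u) (fun _ => θ) N Φ), z ∈ Φ.good := by
  exact mem_ae_iff.2 (localGibbsLaw_compl_good (N := N) c θ u Φ)

/-- **Integrability on the time–phase-space product**: for `X ∈ L¹(G_N)` measurable, `(r, z) ↦ X(Φ_r z)` is
integrable on `[0,h] × G_N` (joint a.e.-measurability of the flow + stationarity slice by slice). [folklore] -/
theorem integrable_comp_flow_prod (c θ : ℝ) (u : V3)
    (Φ : HardSphereFlow (Torus.geometry (Fin 3)) (hsDiameter σ N) (N + 1))
    [IsProbabilityMeasure (localGibbsLaw σ (fun _ => c) (fun _ => u) (fun _ => θ) N Φ)]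
    {X : Config (N + 1) (Fin 3) T3 → ℝ} (hX : Measurable X)
    (hXi : Integrable X (localGibbsLaw σ (fun _ => c) (fun _ => u) (fun _ => θ) N Φ)) (h : ℝ) :
    Integrable (fun p : ℝ × Config (N + 1) (Fin 3) T3 => X (Φ.flow p.1 p.2))
      ((volume.restrict (Ioc (0 : ℝ) h)).prod (localGibbsLaw σ (fun _ => c) (fun _ => u) (fun _ => θ) N Φ)) := by
  set G := localGibbsLaw σ (fun _ => c) (fun _ => u) (fun _ => θ) N Φ with hGdef
  set μ : Measure ℝ := volume.restrict (Ioc (0 : ℝ) h) with hμ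
  haveI : IsFiniteMeasure μ := by
    rw [hμ]
    exact ⟨by simp [Real.volume_Ioc]⟩
  have hflow : AEMeasurable (fun p : ℝ × Config (N + 1) (Fin 3) T3 => Φ.flow p.1 p.2) (μ.prod G) :=
    aemeasurable_uncurry_flow Φ μ G (localGibbsLaw_compl_good c θ u Φ)
  have hmeas : AEStronglyMeasurable (fun p : ℝ × Config (N + 1) (Fin 3) T3 => X (Φ.flow p.1 p.2)) (μ.prod G) :=
    (hX.comp_aemeasurable hflow).aestronglyMeasurable
  refine ⟨hmeas, ?_⟩
  -- finite integral: Tonelli slice by slice, each slice has the `G`-integral of `‖X‖` by stationarity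
  have hslice : ∀ r : ℝ, ∫⁻ z, ‖X (Φ.flow r z)‖ₑ ∂G = ∫⁻ z, ‖X z‖ₑ ∂G := fun r =>
    (measurePreserving_flow_localGibbsLaw c θ u Φ r).lintegral_comp hX.enorm
  have htonelli : ∫⁻ p, ‖X (Φ.flow p.1 p.2)‖ₑ ∂(μ.prod G) = ∫⁻ r, ∫⁻ z, ‖X (Φ.flow r z)‖ₑ ∂G ∂μ :=
    lintegral_prod _ (hX.comp_aemeasurable hflow).enorm
  show ∫⁻ p, ‖X (Φ.flow p.1 p.2)‖ₑ ∂(μ.prod G) < ⊤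
  rw [htonelli]
  simp only [hslice, lintegral_const]
  exact ENNReal.mul_lt_top hXi.2 (measure_lt_top _ _)

/-- **Time averages have stationary expectation**: `∫ (∫₀ʰ X(Φ_r z) dr) dG_N = h ∫ X dG_N`. [folklore] -/
theorem integral_window_eq (c θ : ℝ) (u : V3)
    (Φ : HardSphereFlow (Torus.geometry (Fin 3)) (hsDiameter σ N) (N + 1))
    [IsProbabilityMeasure (localGibbsLaw σ (fun _ => c) (fun _ => u) (fun _ => θ) N Φ)]
    {X : Config (N + 1) (Fin 3) T3 → ℝ} (hX : Measurable X)
    (hXi : Integrable X (localGibbsLaw σ (fun _ => c) (fun _ => u) (fun _ => θ) N Φ)) {h : ℝ} (hh : 0 ≤ h) :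
    ∫ z, (∫ r in (0 : ℝ)..h, X (Φ.flow r z)) ∂(localGibbsLaw σ (fun _ => c) (fun _ => u) (fun _ => θ) N Φ) =
      h * ∫ z, X z ∂(localGibbsLaw σ (fun _ => c) (fun _ => u) (fun _ => θ) N Φ) := by
  set G := localGibbsLaw σ (fun _ => c) (fun _ => u) (fun _ => θ) N Φ with hGdef
  have hint : Integrable (Function.uncurry fun (z : Config (N + 1) (Fin 3) T3) (r : ℝ) => X (Φ.flow r z))
      (G.prod (volume.restrict (Ioc (0 : ℝ) h))) :=
    (integrable_comp_flow_prod c θ u Φ hX hXi h).swap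
  have h2 : ∀ r : ℝ, ∫ z, X (Φ.flow r z) ∂G = ∫ z, X z ∂G := fun r => by
    have := integral_map (Φ.measurable_flow r).aemeasurable (hX.aestronglyMeasurable (μ := G.map (Φ.flow r)))
    rw [(measurePreserving_flow_localGibbsLaw c θ u Φ r).map_eq] at this
    exact this.symm
  simp only [intervalIntegral.integral_of_le hh]
  rw [integral_integral_swap hint]
  simp only [h2, setIntegral_const, smul_eq_mul]
  rw [Measure.real, Real.volume_Ioc, sub_zero, ENNReal.toReal_ofReal hh]

/-- The window integral is an integrable function of the initial datum. [folklore] -/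
theorem integrable_window (c θ : ℝ) (u : V3)
    (Φ : HardSphereFlow (Torus.geometry (Fin 3)) (hsDiameter σ N) (N + 1))
    [IsProbabilityMeasure (localGibbsLaw σ (fun _ => c) (fun _ => u) (fun _ => θ) N Φ)]
    {X : Config (N + 1) (Fin 3) T3 → ℝ} (hX : Measurable X)
    (hXi : Integrable X (localGibbsLaw σ (fun _ => c) (fun _ => u) (fun _ => θ) N Φ)) {h : ℝ} (hh : 0 ≤ h) :
    Integrable (fun z => ∫ r in (0 : ℝ)..h, X (Φ.flow r z))
      (localGibbsLaw σ (fun _ => c) (fun _ => u) (fun _ => θ) N Φ) := by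
  have hint := (integrable_comp_flow_prod c θ u Φ hX hXi h).swap
  simp only [intervalIntegral.integral_of_le hh]
  simpa [Function.comp] using hint.integral_prod_left

end TimeAverage

end BoltzmannGreenKuboOrthMomentum

end Summit.AtomisticToContinuum.HydrodynamicLimit.Theorems

end
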